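import Summits.QuantumFields.BalabanUV.Beta.D1BFx.FiniteStencilCalculus
import Literature.MathematicalPhysics.QuantumFieldTheory.Balaban1983to89.Beta.GradedBubbles

/-!
# `BalabanUV.Beta.D1BFx.StencilRealisation` — road «BF-x» for binder row D1, slot (SPLIT) ∕ leaf A1.ii, part 2 (the `ℤ⁴` bridge):
# ADDITIVITY OF THE ONE-LOOP WORDS ON FINITELY SUPPORTED STENCILS OVER ANY LEG, THE KERNEL REALISATION `realK` OF an3's LOCATED-PAIR
# LISTS, AND **`bubble (δ·g) (realK z z V) (realK (z+w) (z+w) W) = GradedBubbles.bub g g V W (w)`** — the road's `ExpKernelCalculus`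
# bubble over a frozen fibre-diagonal leg IS an3's `ℤ⁴` bubble table, letter for letter

HONEST DEPENDENCY (page 1, mandatory): continuum YM on T⁴ ⇐ BetaPertH ∧ nine spine estimates (0/9 proved); BetaPertH ⇐ (D1) ∧ (D4) ∧
CAP+tail; G-an2-4 gates asym, D1 and NE2/3/4.  HONEST FRAMING (cell contract, verbatim): «discharging `BetaPertH` makes Bałaban's UV
stability UNCONDITIONAL — a real constructive-QFT result; it is NOT the continuum limit and NOT the Clay problem.»  THIS MODULE DISCHARGES
NOTHING of the wall: [folklore] finite-support bookkeeping over the UNMODIFIED definitions of an2's `Beta.ExpKernelCalculus` (`comp`, `tr`, `bubble`)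
and an3's `Beta.GradedBubbles` (`LP`, `Stn`, `term`, `bubRow`, `bub`), imported BY NAME, plus ONE definition with a body ([our object] `realK`, the
`ℤ⁴`-kernel analogue of an3's torus realisation `GradedStencilDictionary.real`; asserts nothing).  No `Prop` minted, nothing printed asserted,
0 sorry.  0 wall binders instantiated; NOT D1, NOT `BetaPertH`, NOT continuum, NOT Clay.

ABSOLUTE RULE (cell charter, verbatim): «No internally-minted statement may enter as a cited fact. Every hypothesis is either kernel-proved in
this package or a verbatim quotation of a PUBLISHED theorem with page reference. The manuscript(s) under audit are NOT citable for their own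
disputed steps — they are the thing under adjudication; programme-internal (2001/route/tribunal) claims are never citable.»

WHY (skeleton v1.6 slot (SPLIT) = A0 ∘ A1.ii; `FiniteStencilCalculus` header).  The MAIN term of slot (SPLIT) is obtained from the road's fine
kernel at base point `b` by FREEZING the gluon leg to the fibre-diagonal translation-invariant kernel `δ_{ab}·Gf n b (y − x)` (the difference is a
flat-graded REST term of A3.c class); over a frozen leg the bubble of the road's finitely supported stencils is a finite table, and THIS FILE
identifies that table with an3's `GradedBubbles.bub` — the currency in which `VecTableZ4.three_sectors_bf_Z4` ∕ `model_table_free_eq_lattBubble_bf`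
deliver `bfKernel` = `SquareTable.stK`'s closed form.  What remains for A1.ii after this file: write the road's E-sector (+ local Feynman
completion) and ghost stencils as `realK` of an3's `WilsonStencilZ4` lists (part 3), then quote `VecTableZ4` (part 4).
[an3's torus link `GradedStencilDictionary.trace_real_bubble` is the finite-torus twin of §3 here; nothing of it is used or restated.]

CONTENT (all [folklore]; §1 for any `D`, finite fibre `F`; §2–§3 on `ℤ⁴` with a finite internal index `I`).
* §1 ADDITIVITY ∕ HOMOGENEITY OF THE WORDS ON FINITELY SUPPORTED STENCILS, ANY LEG: `comp_add_right_of_rowSupp`, `comp_add_left_of_colSupp`,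
  `comp_add_right_of_colSupp_left`, `tr_add_of_diagSupp`, `comp_smul_right`, `comp_smul_left`, `tr_smul` (the three `smul` rules hypothesis-free),
  **`bubble_add_left_of_supp`**, **`bubble_add_right_of_supp`**, `bubble_smul_left`, `bubble_smul_right` (the zero rules are the landed `KernelWardRelative.bubble_zero_left` ∕ `DressedBubbleBridge.bubble_zero_right`, re-derived inline where used).
* §2 [our object] `realK zr zc V` (row base point `zr`, column base point `zc`; `Σ_{(x,y,m)∈V} elemK (zr + x) (zc + y) m`), its supports
  `realK_rowSupp` ∕ `realK_colSupp` (in the finite point sets `rowPts` ∕ `colPts`, written as `List.toFinset` images — no new definition).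
* §3 THE BRIDGE over the frozen leg `A x y a b = δ_{ab}·g (y − x)`: `bubble_elemK_elemK_diag'` (the `g (y − x)` convention: NO evenness needed),
  `bubble_realK_elemK` (one located pair against a list = `bubRow`), **`bubble_realK_realK`** (`= bub (fun _ _ => g) (fun _ _ => g) V W L k w`, every
  `L k`: an3's scale indices are dummies for a fixed leg).
Unit `b2b-balaban-beta-d1-p2` (road owner, gen 2); `LEAVES-BFx.md` row A1.ii (part 2).
-/

open Finset
open scoped BigOperators
open Literature.MathematicalPhysics.QuantumFieldTheory.Balaban1983to89.Beta
open ExpKernelCalculus (Site MKer comp tr bubble tadpole)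
open DyadicShell (Pt)
open GradedBubbles (LP Stn term bubRow bub)
open Summit.QuantumFields.BalabanUV.Beta.D1BFx.FiniteStencilCalculus

namespace Summit.QuantumFields.BalabanUV.Beta.D1BFx.StencilRealisation

/-! ## §1 Additivity and homogeneity of the one-loop words on finitely supported stencils, any leg -/

section Additive

variable {D : ℕ} {F : Type*} [Fintype F]

/-- [folklore] `comp A (V + V′) = comp A V + comp A V′` for right factors supported in the rows of one finite set. -/
theorem comp_add_right_of_rowSupp (A V V' : MKer D F) {S : Finset (Site D)}
    (hV : ∀ y z f b, y ∉ S → V y z f b = 0) (hV' : ∀ y z f b, y ∉ S → V' y z f b = 0) :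
    comp A (V + V') = comp A V + comp A V' := by
  have hVV : ∀ y z f b, y ∉ S → (V + V') y z f b = 0 := fun y z f b hy => by
    simp only [Pi.add_apply, hV y z f b hy, hV' y z f b hy, add_zero]
  funext x z a b
  simp only [Pi.add_apply]
  rw [comp_eq_sum_of_rowSupp A _ hVV, comp_eq_sum_of_rowSupp A V hV, comp_eq_sum_of_rowSupp A V' hV', ← sum_add_distrib]
  refine sum_congr rfl fun y _ => ?_
  rw [← sum_add_distrib]
  exact sum_congr rfl fun f _ => by simp only [Pi.add_apply]; ring

/-- [folklore] `comp (K + K′) M = comp K M + comp K′ M` for left factors supported in the columns of one finite set. -/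
theorem comp_add_left_of_colSupp (K K' M : MKer D F) {T : Finset (Site D)}
    (hK : ∀ x y a f, y ∉ T → K x y a f = 0) (hK' : ∀ x y a f, y ∉ T → K' x y a f = 0) :
    comp (K + K') M = comp K M + comp K' M := by
  have hKK : ∀ x y a f, y ∉ T → (K + K') x y a f = 0 := fun x y a f hy => by
    simp only [Pi.add_apply, hK x y a f hy, hK' x y a f hy, add_zero]
  funext x z a b
  simp only [Pi.add_apply]
  rw [comp_eq_sum_of_colSupp _ M hKK, comp_eq_sum_of_colSupp K M hK, comp_eq_sum_of_colSupp K' M hK', ← sum_add_distrib]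
  refine sum_congr rfl fun y _ => ?_
  rw [← sum_add_distrib]
  exact sum_congr rfl fun f _ => by simp only [Pi.add_apply]; ring

/-- [folklore] `comp K (M + M′) = comp K M + comp K M′` for a LEFT factor supported in the columns of a finite set (the right factors arbitrary). -/
theorem comp_add_right_of_colSupp_left (K M M' : MKer D F) {T : Finset (Site D)} (hK : ∀ x y a f, y ∉ T → K x y a f = 0) :
    comp K (M + M') = comp K M + comp K M' := by
  funext x z a b
  simp only [Pi.add_apply]
  rw [comp_eq_sum_of_colSupp K _ hK, comp_eq_sum_of_colSupp K M hK, comp_eq_sum_of_colSupp K M' hK, ← sum_add_distrib]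
  refine sum_congr rfl fun y _ => ?_
  rw [← sum_add_distrib]
  exact sum_congr rfl fun f _ => by simp only [Pi.add_apply]; ring

/-- [folklore] `tr (K + K′) = tr K + tr K′` for kernels with diagonals supported in one finite set. -/
theorem tr_add_of_diagSupp (K K' : MKer D F) {S : Finset (Site D)} (hK : ∀ x a, x ∉ S → K x x a a = 0)
    (hK' : ∀ x a, x ∉ S → K' x x a a = 0) : tr (K + K') = tr K + tr K' := by
  have hKK : ∀ x a, x ∉ S → (K + K') x x a a = 0 := fun x a hx => by simp only [Pi.add_apply, hK x a hx, hK' x a hx, add_zero]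
  rw [tr_eq_sum_of_diagSupp _ hKK, tr_eq_sum_of_diagSupp K hK, tr_eq_sum_of_diagSupp K' hK', ← sum_add_distrib]
  refine sum_congr rfl fun x _ => ?_
  rw [← sum_add_distrib]
  exact sum_congr rfl fun a _ => by simp only [Pi.add_apply]

/-- [folklore] `comp A (c • V) = c • comp A V` (no hypothesis). -/
theorem comp_smul_right (A V : MKer D F) (c : ℝ) : comp A (c • V) = c • comp A V := by
  funext x z a b
  simp only [comp, Pi.smul_apply, smul_eq_mul]
  rw [← tsum_mul_left]
  refine tsum_congr fun y => ?_
  rw [mul_sum]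
  exact sum_congr rfl fun f _ => by ring

/-- [folklore] `comp (c • K) M = c • comp K M` (no hypothesis). -/
theorem comp_smul_left (K M : MKer D F) (c : ℝ) : comp (c • K) M = c • comp K M := by
  funext x z a b
  simp only [comp, Pi.smul_apply, smul_eq_mul]
  rw [← tsum_mul_left]
  refine tsum_congr fun y => ?_
  rw [mul_sum]
  exact sum_congr rfl fun f _ => by ring

/-- [folklore] `tr (c • K) = c · tr K` (no hypothesis). -/
theorem tr_smul (K : MKer D F) (c : ℝ) : tr (c • K) = c * tr K := by
  simp only [tr, Pi.smul_apply, smul_eq_mul]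
  rw [← tsum_mul_left]
  exact tsum_congr fun x => by rw [mul_sum]

/-- [folklore] **THE BUBBLE IS ADDITIVE IN THE FIRST STENCIL** for finitely supported stencils over ANY leg: `V, V′` supported in rows `S₁` ∕
columns `T₁`, `W` supported in columns `T₂`. -/
theorem bubble_add_left_of_supp (A V V' W : MKer D F) {S₁ T₁ T₂ : Finset (Site D)}
    (hVr : ∀ y z f b, y ∉ S₁ → V y z f b = 0) (hVc : ∀ y z f b, z ∉ T₁ → V y z f b = 0)
    (hV'r : ∀ y z f b, y ∉ S₁ → V' y z f b = 0) (hV'c : ∀ y z f b, z ∉ T₁ → V' y z f b = 0)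
    (hWc : ∀ y z f b, z ∉ T₂ → W y z f b = 0) :
    bubble A (V + V') W = bubble A V W + bubble A V' W := by
  unfold bubble
  have hcV : ∀ x y a f, y ∉ T₁ → comp A V x y a f = 0 := fun x y a f hy => comp_eq_zero_of_colSupp_right A V hVc x y hy a f
  have hcV' : ∀ x y a f, y ∉ T₁ → comp A V' x y a f = 0 := fun x y a f hy => comp_eq_zero_of_colSupp_right A V' hV'c x y hy a f
  have hcW : ∀ x y a f, y ∉ T₂ → comp A W x y a f = 0 := fun x y a f hy => comp_eq_zero_of_colSupp_right A W hWc x y hy a f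
  have hd : ∀ K : MKer D F, ∀ x a, x ∉ T₂ → comp K (comp A W) x x a a = 0 := fun K x a hx =>
    comp_eq_zero_of_colSupp_right K (comp A W) hcW x x hx a a
  rw [comp_add_right_of_rowSupp A V V' hVr hV'r, comp_add_left_of_colSupp _ _ _ hcV hcV',
    tr_add_of_diagSupp _ _ (hd (comp A V)) (hd (comp A V'))]

/-- [folklore] **THE BUBBLE IS ADDITIVE IN THE SECOND STENCIL** for finitely supported stencils over ANY leg: `V` supported in columns `T₁`,
`W, W′` supported in rows `S₂` ∕ columns `T₂`. -/
theorem bubble_add_right_of_supp (A V W W' : MKer D F) {T₁ S₂ T₂ : Finset (Site D)}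
    (hVc : ∀ y z f b, z ∉ T₁ → V y z f b = 0)
    (hWr : ∀ y z f b, y ∉ S₂ → W y z f b = 0) (hWc : ∀ y z f b, z ∉ T₂ → W y z f b = 0)
    (hW'r : ∀ y z f b, y ∉ S₂ → W' y z f b = 0) (hW'c : ∀ y z f b, z ∉ T₂ → W' y z f b = 0) :
    bubble A V (W + W') = bubble A V W + bubble A V W' := by
  unfold bubble
  have hcV : ∀ x y a f, y ∉ T₁ → comp A V x y a f = 0 := fun x y a f hy => comp_eq_zero_of_colSupp_right A V hVc x y hy a f
  have hcW : ∀ x y a f, y ∉ T₂ → comp A W x y a f = 0 := fun x y a f hy => comp_eq_zero_of_colSupp_right A W hWc x y hy a f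
  have hcW' : ∀ x y a f, y ∉ T₂ → comp A W' x y a f = 0 := fun x y a f hy => comp_eq_zero_of_colSupp_right A W' hW'c x y hy a f
  rw [comp_add_right_of_rowSupp A W W' hWr hW'r, comp_add_right_of_colSupp_left _ _ _ hcV,
    tr_add_of_diagSupp _ _ (fun x a hx => comp_eq_zero_of_colSupp_right _ _ hcW x x hx a a)
      (fun x a hx => comp_eq_zero_of_colSupp_right _ _ hcW' x x hx a a)]

/-- [folklore] `bubble A (c • V) W = c · bubble A V W` (no hypothesis). -/
theorem bubble_smul_left (A V W : MKer D F) (c : ℝ) : bubble A (c • V) W = c * bubble A V W := by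
  unfold bubble
  rw [comp_smul_right, comp_smul_left, tr_smul]

/-- [folklore] `bubble A V (c • W) = c · bubble A V W` (no hypothesis). -/
theorem bubble_smul_right (A V W : MKer D F) (c : ℝ) : bubble A V (c • W) = c * bubble A V W := by
  unfold bubble
  rw [comp_smul_right A W, comp_smul_right, tr_smul]

end Additive

/-! ## §2 The kernel realisation of a located-pair list -/

section Real

variable {I : Type*}

/-- [our object] **THE `ℤ⁴`-KERNEL REALISATION OF A LOCATED-PAIR LIST** with row base point `zr` and column base point `zc`:
`realK zr zc V = Σ_{(x, y, m) ∈ V} elemK (zr + x) (zc + y) m` (the kernel analogue of an3's torus `GradedStencilDictionary.real`).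
A DEFINITION; asserts nothing. -/
def realK (zr zc : Pt) : Stn I → MKer 4 I
  | [] => 0
  | p :: V => elemK (zr + p.x) (zc + p.y) (fun a b => p.m a b) + realK zr zc V

/-- [our object] Unfolding on the empty list. -/
@[simp] theorem realK_nil (zr zc : Pt) : realK zr zc ([] : Stn I) = 0 := rfl

/-- [our object] Unfolding on a cons. -/
@[simp] theorem realK_cons (zr zc : Pt) (p : LP I) (V : Stn I) :
    realK zr zc (p :: V) = elemK (zr + p.x) (zc + p.y) (fun a b => p.m a b) + realK zr zc V := rfl

/-- [folklore] The realisation is supported in the rows `{zr + x_p : p ∈ V}`. -/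
theorem realK_rowSupp (zr zc : Pt) (V : Stn I) :
    ∀ y z f b, y ∉ (V.map fun p => zr + p.x).toFinset → realK zr zc V y z f b = 0 := by
  induction V with
  | nil => intro y z f b _; rfl
  | cons p V ih =>
    intro y z f b hy
    rw [List.map_cons, List.toFinset_cons, mem_insert, not_or] at hy
    rw [realK_cons, Pi.add_apply, Pi.add_apply, Pi.add_apply, Pi.add_apply, ih y z f b hy.2, add_zero, elemK_apply, if_neg]
    exact fun h => hy.1 h.1

/-- [folklore] The realisation is supported in the columns `{zc + y_p : p ∈ V}`. -/
theorem realK_colSupp (zr zc : Pt) (V : Stn I) :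
    ∀ y z f b, z ∉ (V.map fun p => zc + p.y).toFinset → realK zr zc V y z f b = 0 := by
  induction V with
  | nil => intro y z f b _; rfl
  | cons p V ih =>
    intro y z f b hz
    rw [List.map_cons, List.toFinset_cons, mem_insert, not_or] at hz
    rw [realK_cons, Pi.add_apply, Pi.add_apply, Pi.add_apply, Pi.add_apply, ih y z f b hz.2, add_zero, elemK_apply, if_neg]
    exact fun h => hz.1 h.2

/-- [folklore] Row support of a realisation, enlarged to any finite superset. -/
theorem realK_rowSupp_of_subset (zr zc : Pt) (V : Stn I) {S : Finset Pt} (hS : (V.map fun p => zr + p.x).toFinset ⊆ S) :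
    ∀ y z f b, y ∉ S → realK zr zc V y z f b = 0 :=
  fun y z f b hy => realK_rowSupp zr zc V y z f b fun h => hy (hS h)

/-- [folklore] Column support of a realisation, enlarged to any finite superset. -/
theorem realK_colSupp_of_subset (zr zc : Pt) (V : Stn I) {T : Finset Pt} (hT : (V.map fun p => zc + p.y).toFinset ⊆ T) :
    ∀ y z f b, z ∉ T → realK zr zc V y z f b = 0 :=
  fun y z f b hz => realK_colSupp zr zc V y z f b fun h => hz (hT h)

/-- [folklore] An elementary insertion is supported in the rows of any finite set containing its row site. -/
theorem elemK_rowSupp_of_mem {p : Pt} (q : Pt) (m : I → I → ℝ) {S : Finset Pt} (hp : p ∈ S) :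
    ∀ y z f b, y ∉ S → elemK p q m y z f b = 0 :=
  fun y z f b hy => elemK_rowSupp p q m y z f b fun h => hy (by rw [mem_singleton] at h; rwa [h])

/-- [folklore] An elementary insertion is supported in the columns of any finite set containing its column site. -/
theorem elemK_colSupp_of_mem (p : Pt) {q : Pt} (m : I → I → ℝ) {T : Finset Pt} (hq : q ∈ T) :
    ∀ y z f b, z ∉ T → elemK p q m y z f b = 0 :=
  fun y z f b hz => elemK_colSupp p q m y z f b fun h => hz (by rw [mem_singleton] at h; rwa [h])

end Real

/-! ## §3 The bridge: `bubble` over a frozen fibre-diagonal leg IS an3's `bub` -/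

section Bridge

variable {I : Type*} [Fintype I]

/-- [folklore] **TWO ELEMENTARY INSERTIONS OVER THE FROZEN LEG `A x y a b = δ_{ab}·g (y − x)`** (the convention in which NO evenness of `g` is
needed): `bubble A (elemK p q m) (elemK p′ q′ m′) = g (p − q′) · g (p′ − q) · Σ_a Σ_f m a f · m′ f a`. -/
theorem bubble_elemK_elemK_diag' [DecidableEq I] (g : Pt → ℝ) {A : MKer 4 I} (hA : ∀ x y a b, A x y a b = if a = b then g (y - x) else 0)
    (p q p' q' : Pt) (m m' : I → I → ℝ) :
    bubble A (elemK p q m) (elemK p' q' m') = g (p - q') * g (p' - q) * ∑ a, ∑ f, m a f * m' f a := by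
  rw [bubble_elemK_elemK, mul_sum]
  refine sum_congr rfl fun a _ => ?_
  rw [mul_sum]
  refine sum_congr rfl fun f _ => ?_
  have h1 : ∑ f₁, A q' p a f₁ * m f₁ f = g (p - q') * m a f := by
    rw [sum_eq_single a (fun f₁ _ hf₁ => by rw [hA, if_neg (Ne.symm hf₁), zero_mul]) (fun h => absurd (mem_univ a) h), hA, if_pos rfl]
  have h2 : ∑ f₂, A q p' f f₂ * m' f₂ a = g (p' - q) * m' f a := by
    rw [sum_eq_single f (fun f₂ _ hf₂ => by rw [hA, if_neg (Ne.symm hf₂), zero_mul]) (fun h => absurd (mem_univ f) h), hA, if_pos rfl]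
  rw [h1, h2]
  ring

/-- [folklore] The trace of a product of two internal matrices as the explicit double sum. -/
theorem trace_mul_eq_sum (m m' : Matrix I I ℝ) : (m * m').trace = ∑ a, ∑ f, m a f * m' f a := by
  simp only [Matrix.trace, Matrix.diag_apply, Matrix.mul_apply]

/-- [folklore] **ONE LOCATED PAIR (first vertex, base point `z`) AGAINST A REALISED LIST (second vertex, base point `z + w`) IS `bubRow`**
over the frozen leg `A x y a b = δ_{ab}·g (y − x)`. -/
theorem bubble_elemK_realK [DecidableEq I] (g : Pt → ℝ) {A : MKer 4 I} (hA : ∀ x y a b, A x y a b = if a = b then g (y - x) else 0)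
    (p : LP I) (W : Stn I) (z w : Pt) (L k : ℕ) :
    bubble A (elemK (z + p.x) (z + p.y) (fun a b => p.m a b)) (realK (z + w) (z + w) W) = bubRow (fun _ _ => g) (fun _ _ => g) p W L k w := by
  induction W with
  | nil =>
    -- `bubble A V 0 = 0` (landed as `DressedBubbleBridge.bubble_zero_right`; re-derived inline from homogeneity to keep the imports minimal)
    have h0 := bubble_smul_right A (elemK (z + p.x) (z + p.y) (fun a b => p.m a b)) (0 : MKer 4 I) 0
    rw [zero_smul] at h0
    rw [realK_nil, h0, zero_mul]
    rfl
  | cons q W ih =>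
    have hWr := realK_rowSupp_of_subset (I := I) (z + w) (z + w) W
      (subset_insert (z + w + q.x) ((W.map fun r => z + w + r.x).toFinset))
    have hWc := realK_colSupp_of_subset (I := I) (z + w) (z + w) W
      (subset_insert (z + w + q.y) ((W.map fun r => z + w + r.y).toFinset))
    rw [realK_cons, bubble_add_right_of_supp A _ _ _ (elemK_colSupp (z + p.x) (z + p.y) _)
        (elemK_rowSupp_of_mem (z + w + q.y) _ (mem_insert_self _ _)) (elemK_colSupp_of_mem (z + w + q.x) _ (mem_insert_self _ _)) hWr hWc,
      ih, bubble_elemK_elemK_diag' g hA]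
    show _ = term (fun _ _ => g) (fun _ _ => g) p q L k w + bubRow (fun _ _ => g) (fun _ _ => g) p W L k w
    rw [term, trace_mul_eq_sum]
    have e1 : z + p.x - (z + w + q.y) = p.x - q.y - w := by abel
    have e2 : z + w + q.x - (z + p.y) = w + (q.x - p.y) := by abel
    rw [e1, e2]
    ring

/-- [folklore] **THE BRIDGE.**  Over the frozen fibre-diagonal translation-invariant leg `A x y a b = δ_{ab}·g (y − x)`, the road's
`ExpKernelCalculus.bubble` of the kernel realisations of two located-pair lists — the first at base point `z`, the second at `z + w` — IS an3's
`ℤ⁴` bubble table `GradedBubbles.bub` through the constant leg family `fun _ _ => g`, at the relative position `w` (every dummy scale `L k`):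
`bubble A (realK z z V) (realK (z + w) (z + w) W) = bub g g V W L k w`.  No evenness, no decay, no summability hypothesis. -/
theorem bubble_realK_realK [DecidableEq I] (g : Pt → ℝ) {A : MKer 4 I} (hA : ∀ x y a b, A x y a b = if a = b then g (y - x) else 0)
    (V W : Stn I) (z w : Pt) (L k : ℕ) :
    bubble A (realK z z V) (realK (z + w) (z + w) W) = bub (fun _ _ => g) (fun _ _ => g) V W L k w := by
  induction V with
  | nil =>
    -- `bubble A 0 W = 0` (landed as `KernelWardRelative.bubble_zero_left`; re-derived inline from homogeneity to keep the imports minimal)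
    have h0 := bubble_smul_left A (0 : MKer 4 I) (realK (z + w) (z + w) W) 0
    rw [zero_smul] at h0
    rw [realK_nil, h0, zero_mul]
    rfl
  | cons p V ih =>
    have hVr := realK_rowSupp_of_subset (I := I) z z V (subset_insert (z + p.x) ((V.map fun r => z + r.x).toFinset))
    have hVc := realK_colSupp_of_subset (I := I) z z V (subset_insert (z + p.y) ((V.map fun r => z + r.y).toFinset))
    rw [realK_cons, bubble_add_left_of_supp A _ _ _ (elemK_rowSupp_of_mem (z + p.y) _ (mem_insert_self _ _))
        (elemK_colSupp_of_mem (z + p.x) _ (mem_insert_self _ _)) hVr hVc (realK_colSupp (z + w) (z + w) W),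
      ih, bubble_elemK_realK g hA]
    rfl

end Bridge

end Summit.QuantumFields.BalabanUV.Beta.D1BFx.StencilRealisation
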